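/-
Copyright (c) 2026 the pub-hodgecm-mathlib formalisation cell (harness21).  Prover seat hodgecm-mathlib-LD2-p02 (g6), brick (β) of ROAD O (memo
`F0/P6/LD/LD1-p01/g5/ROAD-O-orthogonal-copy.v1.LD1-p01g5.md` e83a8888; hands v2 2026-09-02T13:02:25Z, binder list of the assembler LD1-p01 (g5)), 2026-09-02.
THEOREMS ONLY (no definition, no named fact, no `sorry`, no instance, no notation).  `--supports stmt-HodgeConjecture-24832` (helper).
-/
import Summits.HodgeConjecture.HodgeConjecture.Theorems.F0LD2ArchSignAtAnyPhase
import HarnessLib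

/-!
# [Liu2021, Lem. D.2 (3)] at the place of `ι` from a TORUS-COVARIANT VECTOR instead of a holomorphic cotangent form: the two-sided sign theorem
# and its relative corollary with the binder `IsHolCotangentAt₂` replaced by «for every cone frame `𝔣′`, `P` contains a non-zero vector on which
# the torus of `𝔣′` acts by the cotangent character» (ROAD O, brick (β))

Cell hodgecm-mathlib FLOOR 0, programme P6, half-A line LD (crux `hLiu418` = `stmt-HodgeConjecture-24832`), ROAD O of LD1-p01 (g5) (retire the printed
letter (B6) #185 by [Liu2021, Cor. B.6 (3)]'s multiplicity argument with the second realisation chosen ORTHOGONAL to the theta span).  Its pin needs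
[Liu2021, Lem. D.2 (3)] at the place of `ι` for a discrete `P` NOT known to be holomorphic-cotangent as a FUNCTION space, but carrying — transported along
a unitary intertwiner `u : P₀ ≃ᵤ P` from a holomorphic-cotangent `P₀` — a non-zero vector on which the archimedean frame torus acts by the cotangent
character.  This file is ★ `F0LD2ArchSignAtAnyPhase` §2–§3 with exactly that abstraction (assembler's binder list, LD bus 2026-09-02T13:02:25Z):
* §1 **`torusCovariant_of_isHolCotangentAt₂`** — DISCHARGE of the new binder from the old: `P` hol-cotangent at `w₀` for a cone frame `𝔣` has, for EVERY
  cone frame `𝔣′` of `H` at `w₀`, a non-zero `w ∈ P` with `R(ι γ) w = (a q⁻¹) • w` for every `γ ∈ U(σ_{w₀}H)(ℂ)` diagonal in `𝔣′` (`γ v₀′ = q v₀′`,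
  `γ t₀′ = a t₀′`, `q ≠ 0`): `w := R(ι h)[f]`, `f` the hol test vector (★ `exists_toLp_ne_zero_of_isHolCotangentAt₂`), `h` the ANY-PHASE frame-to-frame
  unitary (★ `exists_archLocal_frame_to_frame_of_frame`), law ★ `F0LD2ConeTorusCovariance.rightRegular_adelicSingle_torus_smul`; the assembler obtains the
  binder for the orthogonal copy by pushing these witnesses through `u` (a unitary intertwiner of `rightRegular` preserves every law `R(x) w = c • w`);
* §2 **`re_mul_im_lt_zero_of_meets_of_torusCovariant`** — ★ `re_mul_im_lt_zero_of_meets_of_hol₂'` VERBATIM except: binders `(𝔣 : ConeFrame L H w₀)`,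
  `(hhol : P.IsHolCotangentAt₂ … w₀ 𝔣)` replaced by `(hcov : ∀ 𝔣′, ∃ w ∈ P.space.toSubmodule, w ≠ 0 ∧ ∀ γ q a, q ≠ 0 → γ v₀′ = q v₀′ → γ t₀′ = a t₀′ →
  R(ι γ) w = (a q⁻¹) • w)`; in the ★ proof only «frame to frame ∕ hol test vector ∕ torus covariance» change (`obtain ⟨wf, hwmem, hwne, hH⟩ := hcov 𝔣′`),
  the character computation `hchar`, ★ `integer_equations₂` and the read-out are untouched;
* §3 **`im_mul_im_pos_of_meets_of_torusCovariant`** — ★ `im_mul_im_pos_of_meets_of_hol₂'` with `(P, a′, hcov)`, `(P′, a″, hcov′)` for the two hol₂ binders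
  (the cone frame `𝔣` at `cmPlace L ι` is kept: it witnesses `Re((e♮ t)⁻¹) ≠ 0`, ★ `re_inv_embedding_ne_zero_of_coneFrame`); the MIXED form
  `im_mul_im_pos_of_meets_of_hol₂_of_torusCovariant` (`P` hol₂, `P′` covariant) composes §3 with §1 (with §1 on both sides one recovers ★ §3 verbatim).
HONEST SCOPE.  Helpers (`--supports`); no organ, no line and not HC_CM is proved here — HC_CM stays conditional on the remaining printed inputs (hLiu418,
h413) until rung 0 closes.  References: [Liu2021] arXiv:2102.11518, App. D Lem. D.2 (3) (p. 127 L40 – p. 128 L2), proof of Prop. D.4 (1) (p. 131 L27–34),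
proof of Cor. B.6 (3) (p. 99 L41–46); [KonnoKonno2007] Thm. 5.4; [Borel1997] §5.13–§5.14; [BorelJacquet1979] §4.1, §4.6; [Dixmier1977] §13.1.3.
-/

set_option autoImplicit false
set_option linter.dupNamespace false
noncomputable section
open NumberField NumberField.InfinitePlace MeasureTheory IsDedekindDomain Matrix
open scoped Matrix ComplexOrder ENNReal TensorProduct SchwartzMap Classical InnerProductSpace ComplexConjugate

namespace Summit.HodgeConjecture.HodgeConjecture.Cruxes.HLiu418.F0LD2ArchSignOfTorusCovariant
open _root_.MeasureTheory
open Literature.NumberTheory.Automorphic Literature.NumberTheory.Automorphic.UnitaryGroup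
open Literature.NumberTheory.Automorphic.UnitaryGroup.CotangentForms (toQuotFun)
open Literature.NumberTheory.Automorphic.UnitaryCurveForms
open Literature.NumberTheory.Automorphic.IdeleClassGroup
open Literature.NumberTheory.Automorphic.Liu2021 Literature.NumberTheory.Automorphic.Liu2021.CinfThetaTorus
open Literature.NumberTheory.Automorphic.Liu2021.Def411WeilCarriers Literature.NumberTheory.Automorphic.Liu2021.Def411WeilCarriersDoubling
open Literature.NumberTheory.GelbartRogawski1991 Literature.NumberTheory.GelbartRogawski1991.UnitaryDualPair
open Literature.NumberTheory.GelbartRogawski1991.GRConstruction Literature.NumberTheory.Weil1964 Literature.RepresentationTheory.Liu2021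
open Literature.RepresentationTheory.HeisenbergGroup Literature.Analysis.SegalBargmann
open Literature.AlgebraicGeometry.ShimuraVarieties Literature.Geometry.ComplexHyperbolic
open Summit.HodgeConjecture.HodgeConjecture.Cruxes.HLiu418.F0LD1ThetaTransportKit
open Summit.HodgeConjecture.HodgeConjecture.Cruxes.HLiu418.F0LD2FrameTransportPin (continuous_of_pin mem_range_toAdelic_of_pin)
open Summit.HodgeConjecture.HodgeConjecture.Cruxes.HLiu418.F0LD2ScaledFrameCone Summit.HodgeConjecture.HodgeConjecture.Cruxes.HLiu418.F0LD2ConeTorusCovariance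
open Summit.HodgeConjecture.HodgeConjecture.Cruxes.HLiu418.F0LD2ThetaCyclicity Summit.HodgeConjecture.HodgeConjecture.Cruxes.HLiu418.F0LD2ThetaTorusEigenclass
open Summit.HodgeConjecture.HodgeConjecture.Cruxes.HLiu418.F0LD2ThetaTensorCLM (exists_clm_comp_toLp_lineThetaLift_tmul)
open Summit.HodgeConjecture.HodgeConjecture.Cruxes.HLiu418.F0LD2CurveHolTestVector (exists_toLp_ne_zero_of_isHolCotangentAt₂)
open Summit.HodgeConjecture.HodgeConjecture.Cruxes.HLiu418.F0LD2ArchSignAt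
open Summit.HodgeConjecture.HodgeConjecture.Cruxes.HLiu418.F0LD2ArchSignAtAnyPhase

/-! ## §1 The discharge: a holomorphic-cotangent `P` carries, for every cone frame, a non-zero torus-covariant vector -/
section Discharge
variable (L : Type) [Field L] [NumberField L] [IsCMField L] (H : Matrix (Fin 2) (Fin 2) L) (dV : Fin 2 → L)
  (hdV : ∀ i, IsCMField.complexConj L (dV i) = dV i) (t : L) (ht : t ≠ 0) (g : GL (Fin 2) L)
  (hg : formCongr ((IsCMField.complexConj L : L ≃ₐ[↥(maximalRealSubfield L)] L) : L →+* L) g (t • H) = Matrix.diagonal dV)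
  (w₀ : {w : InfinitePlace L // w.IsComplex})
  [CompactSpace (adelicGroupData (↥(maximalRealSubfield L)) L (IsCMField.complexConj L) 2 H).automorphicQuotient]
  {μA : Measure (adelicGroupData (↥(maximalRealSubfield L)) L (IsCMField.complexConj L) 2 H).automorphicQuotient}
  [(adelicGroupData (↥(maximalRealSubfield L)) L (IsCMField.complexConj L) 2 H).IsAutomorphicMeasure μA]

include hdV ht hg in
/-- **THE TORUS-COVARIANCE BINDER OF ROAD O IS IMPLIED BY `IsHolCotangentAt₂`.**  If the discrete `P` is holomorphic-cotangent at `w₀` for a cone frame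
`𝔣` of `H` (scaled frame `ᵗ(c̄ g)(t•H)g = diag dV`, `c̄ dV = dV`, ANY phase of `σ_{w₀}(t)`), then for EVERY cone frame `𝔣′` of `H` at `w₀` there is a
non-zero `w ∈ P` on which every `γ ∈ U(σ_{w₀}H)(ℂ)` diagonal in `𝔣′` (`γ v₀′ = q v₀′`, `γ t₀′ = a t₀′`, `q ≠ 0`) acts through `R(adelicSingle w₀ γ)` by
`a q⁻¹` (`w := R(ι h)[f]`: hol test vector `f`, any-phase frame-to-frame `h`, cotangent law ★ `rightRegular_adelicSingle_torus_smul`).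
[cite: Liu2021, App. D Lem. D.2 (3) (p. 127 L40 – p. 128 L2)] [cite: Borel1997, §5.13–§5.14] [cite: Jacobson, Ch. V §7 pp. 150–151; §11 p. 162] -/
theorem torusCovariant_of_isHolCotangentAt₂ (𝔣 : ConeFrame L H w₀)
    (P : DiscreteAutomorphicRep (adelicGroupData (↥(maximalRealSubfield L)) L (IsCMField.complexConj L) 2 H) μA)
    (hhol : P.IsHolCotangentAt₂ (IsCMField.complexConj_ne_one L) (UnitaryGroup.complexConj_smul_infinitePlace L) w₀ 𝔣) :
    ∀ 𝔣' : ConeFrame L H w₀, ∃ w ∈ P.space.toSubmodule, w ≠ 0 ∧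
      ∀ (γ : archLocal L 2 H w₀) (q a : ℂ), q ≠ 0 →
        ((γ : GL (Fin 2) ℂ) : Matrix (Fin 2) (Fin 2) ℂ) *ᵥ 𝔣'.v₀ = q • 𝔣'.v₀ →
        ((γ : GL (Fin 2) ℂ) : Matrix (Fin 2) (Fin 2) ℂ) *ᵥ 𝔣'.t₀ = a • 𝔣'.t₀ →
          (adelicGroupData (↥(maximalRealSubfield L)) L (IsCMField.complexConj L) 2 H).rightRegular μA
              (UnitaryGroup.adelicSingle (↥(maximalRealSubfield L)) L (IsCMField.complexConj L) 2 H (IsCMField.complexConj_ne_one L)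
                (UnitaryGroup.complexConj_smul_infinitePlace L) w₀ γ) w = (a * q⁻¹) • w := by
  intro 𝔣'
  obtain ⟨h, αh, βh, hα, hβ0, hht, hhv⟩ := exists_archLocal_frame_to_frame_of_frame L H dV hdV t ht g hg w₀ 𝔣 𝔣'
  obtain ⟨fh, hfh, hfm, hfmem, hfne⟩ := exists_toLp_ne_zero_of_isHolCotangentAt₂ (μ := μA) P hhol
  have hRU := (adelicGroupData (↥(maximalRealSubfield L)) L (IsCMField.complexConj L) 2 H).isUnitary_rightRegular μA
  refine ⟨(adelicGroupData (↥(maximalRealSubfield L)) L (IsCMField.complexConj L) 2 H).rightRegular μA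
      (UnitaryGroup.adelicSingle (↥(maximalRealSubfield L)) L (IsCMField.complexConj L) 2 H (IsCMField.complexConj_ne_one L)
        (UnitaryGroup.complexConj_smul_infinitePlace L) w₀ h) (hfm.toLp _), P.space.apply_mem_toSubmodule _ hfmem, fun h0 => hfne ?_,
    fun γ q a hq hγv hγt => rightRegular_adelicSingle_torus_smul (μ := μA) hfh hfm 𝔣' h γ hα hβ0 hq hht hhv hγv hγt⟩
  rw [← norm_eq_zero, ← hRU.norm_map (UnitaryGroup.adelicSingle (↥(maximalRealSubfield L)) L (IsCMField.complexConj L) 2 H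
    (IsCMField.complexConj_ne_one L) (UnitaryGroup.complexConj_smul_infinitePlace L) w₀ h) (hfm.toLp _), h0, norm_zero]

end Discharge

/-! ## §2 The two-sided sign theorem from a torus-covariant vector -/

set_option maxHeartbeats 4000000 in -- (as ★: the organ's binder list and the theta/frame telescopes are large; every step is a named ★ lemma)
/-- **[Liu2021, Lem. D.2 (3)] AT RANK 2, CONE MODEL, PINNED TRANSPORT, TWO-SIDED, ANY PHASE OF `σ(t)`, FROM A TORUS-COVARIANT VECTOR** (★
`re_mul_im_lt_zero_of_meets_of_hol₂'` with its binders `𝔣`, `IsHolCotangentAt₂` replaced by `hcov`): `ᵗ(c̄ g)(t•H)g = diag dV`, `w₀ = cmPlaceOver L v₀`,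
`Re(σ_{w₀}(dV p₋)/σ_{w₀}(t)) < 0 < Re(σ_{w₀}(dV p₊)/σ_{w₀}(t))`; if the discrete `P` (compact quotient) MEETS the theta lift from `⟨a′⟩` at `μ′` along the
pinned `ιA`, and for every cone frame `𝔣′` of `H` at `w₀` contains a non-zero vector on which the torus of `𝔣′` acts by the cotangent character
(`γ v₀′ = q v₀′`, `γ t₀′ = a t₀′` ⇒ `R(ι γ) w = (a q⁻¹) • w`), then `Re σ_{w₀}(t) · Im σ_{w₀}(a′·(2·imagUnit L)⁻¹) < 0`.  Road = ★ (cone frame `𝔣′` of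
the columns `p₋, p₊` of `σ(g)`, its covariant vector `wf := hcov 𝔣′`, a Hermite theta class pairing non-trivially with `wf`, the frame torus through the
pin acting on `wf` by `s₊ s₋⁻¹` and on the Hermite class by `∏ s_p^{n_p}`, unitarity of `R` ⇒ character identity ⇒ ★ `integer_equations₂` ⇒ sign).
[cite: Liu2021, App. D Lem. D.2 (3) (p. 127 L40 – p. 128 L2); proof of Prop. 4.13 Case 1 (l. 2137–2141, p. 48)] [cite: KonnoKonno2007, Thm. 5.4] [cite: Borel1997, §5.13–§5.14] -/
theorem re_mul_im_lt_zero_of_meets_of_torusCovariant (L : Type) [Field L] [NumberField L] [IsCMField L] (H : Matrix (Fin 2) (Fin 2) L)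
    (dV : Fin 2 → L) (hdV : ∀ i, IsCMField.complexConj L (dV i) = dV i) (hdV0 : ∀ i, dV i ≠ 0)
    (t : L) (ht : t ≠ 0) (g : GL (Fin 2) L)
    (hg : formCongr ((IsCMField.complexConj L : L ≃ₐ[↥(maximalRealSubfield L)] L) : L →+* L) g (t • H) = Matrix.diagonal dV)
    (v₀ : {v : InfinitePlace (↥(maximalRealSubfield L)) // v.IsReal}) (w₀ : {w : InfinitePlace L // w.IsComplex}) (hw₀ : w₀ = cmPlaceOver L v₀)
    (pm pp : Fin 2) (hne : pp ≠ pm)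
    (hm : (w₀.1.embedding (dV pm) * (w₀.1.embedding t)⁻¹).re < 0) (hp : 0 < (w₀.1.embedding (dV pp) * (w₀.1.embedding t)⁻¹).re)
    [CompactSpace (adelicGroupData (↥(maximalRealSubfield L)) L (IsCMField.complexConj L) 2 H).automorphicQuotient]
    {μA : Measure (adelicGroupData (↥(maximalRealSubfield L)) L (IsCMField.complexConj L) 2 H).automorphicQuotient}
    [(adelicGroupData (↥(maximalRealSubfield L)) L (IsCMField.complexConj L) 2 H).IsAutomorphicMeasure μA]
    {n' : ℕ} (e₁ : Fin 2 × Fin 1 ≃ Fin n')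
    (ιA : (adelicGroupData (↥(maximalRealSubfield L)) L (IsCMField.complexConj L) 2 H).Adelic →*
      ↥(UnitaryGroup.adelic (↥(maximalRealSubfield L)) L (IsCMField.complexConj L) 2 (Matrix.diagonal dV)))
    (hιA : ∀ k, ((ιA k : ↥(UnitaryGroup.adelic (↥(maximalRealSubfield L)) L (IsCMField.complexConj L) 2 (Matrix.diagonal dV))) :
          GL (Fin 2) (AdeleRing (𝓞 L) L)) =
        (toAdeleGL L g)⁻¹ * adelicVal (↥(maximalRealSubfield L)) L (IsCMField.complexConj L) 2 H k * toAdeleGL L g)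
    [CompactSpace (↥(UnitaryGroup.adelic (↥(maximalRealSubfield L)) L (IsCMField.complexConj L) 2 (Matrix.diagonal dV)) ⧸
        (UnitaryGroup.toAdelic (↥(maximalRealSubfield L)) L (IsCMField.complexConj L) 2 (Matrix.diagonal dV)).range)]
    (P : DiscreteAutomorphicRep (adelicGroupData (↥(maximalRealSubfield L)) L (IsCMField.complexConj L) 2 H) μA)
    (μ' : Literature.NumberTheory.Automorphic.IdeleClassGroup L →ₜ* Circle) (hμ' : IsConjugateSymplectic L μ')
    (a' : (↥(maximalRealSubfield L))ˣ)
    (hmeets : MeetsThetaLiftFromLine L 2 H e₁ dV hdV hdV0 P μ' hμ' a' ιA)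
    (hcov : ∀ 𝔣' : ConeFrame L H w₀, ∃ w ∈ P.space.toSubmodule, w ≠ 0 ∧
      ∀ (γ : archLocal L 2 H w₀) (q a : ℂ), q ≠ 0 →
        ((γ : GL (Fin 2) ℂ) : Matrix (Fin 2) (Fin 2) ℂ) *ᵥ 𝔣'.v₀ = q • 𝔣'.v₀ →
        ((γ : GL (Fin 2) ℂ) : Matrix (Fin 2) (Fin 2) ℂ) *ᵥ 𝔣'.t₀ = a • 𝔣'.t₀ →
          (adelicGroupData (↥(maximalRealSubfield L)) L (IsCMField.complexConj L) 2 H).rightRegular μA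
              (UnitaryGroup.adelicSingle (↥(maximalRealSubfield L)) L (IsCMField.complexConj L) 2 H (IsCMField.complexConj_ne_one L)
                (UnitaryGroup.complexConj_smul_infinitePlace L) w₀ γ) w = (a * q⁻¹) • w) :
    (w₀.1.embedding t).re * (w₀.1.embedding (algebraMap (↥(maximalRealSubfield L)) L a' * (2 * imagUnit L)⁻¹)).im < 0 := by
  subst hw₀
  letI : MeasurableSpace (↥(UnitaryGroup.adelic (↥(maximalRealSubfield L)) L (IsCMField.complexConj L) 1 (JW (↥(maximalRealSubfield L)) L a')) ⧸
      (UnitaryGroup.toAdelic (↥(maximalRealSubfield L)) L (IsCMField.complexConj L) 1 (JW (↥(maximalRealSubfield L)) L a')).range) := borel _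
  haveI : BorelSpace (↥(UnitaryGroup.adelic (↥(maximalRealSubfield L)) L (IsCMField.complexConj L) 1 (JW (↥(maximalRealSubfield L)) L a')) ⧸
      (UnitaryGroup.toAdelic (↥(maximalRealSubfield L)) L (IsCMField.complexConj L) 1 (JW (↥(maximalRealSubfield L)) L a')).range) := ⟨rfl⟩
  haveI := normal_range_toAdelic_JW L a'
  have hιA' : Continuous ιA ∧ ∀ ⦃γ : (adelicGroupData (↥(maximalRealSubfield L)) L (IsCMField.complexConj L) 2 H).Adelic⦄,
      γ ∈ (UnitaryGroup.toAdelic (↥(maximalRealSubfield L)) L (IsCMField.complexConj L) 2 H).range →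
        ιA γ ∈ (UnitaryGroup.toAdelic (↥(maximalRealSubfield L)) L (IsCMField.complexConj L) 2 (Matrix.diagonal dV)).range :=
    ⟨continuous_of_pin L 2 H dV g ιA hιA, fun _ hγ => mem_range_toAdelic_of_pin L 2 H dV t ht g hg ιA hιA hγ⟩
  let d : Fin 2 → ℝ := fun p =>
    embedding_of_isReal v₀.2 (⟨dV p, (IsCMField.complexConj_eq_self_iff (K := L) (dV p)).1 (hdV p)⟩ : ↥(maximalRealSubfield L))
  have hd : ∀ p, (cmPlaceOver L v₀).1.embedding (dV p) = ((d p : ℝ) : ℂ) := fun p => embedding_cmPlaceOver_dV L dV hdV v₀ p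
  -- the phase-robust frame sign `τi = Re((σ t)⁻¹)`
  set τi : ℝ := (((cmPlaceOver L v₀).1.embedding t)⁻¹).re with hτi
  have hσt0 : (cmPlaceOver L v₀).1.embedding t ≠ 0 := (map_ne_zero _).2 ht
  have hre : ∀ p, ((cmPlaceOver L v₀).1.embedding (dV p) * ((cmPlaceOver L v₀).1.embedding t)⁻¹).re = d p * τi := fun p => by
    rw [hd, Complex.re_ofReal_mul]
  have hmR : d pm * τi < 0 := by rw [← hre]; exact hm
  have hpR : 0 < d pp * τi := by rw [← hre]; exact hp
  -- the cone frame of the columns and ITS covariant vector (the only change w.r.t. ★: `hcov 𝔣′` replaces frame-to-frame + hol test vector + cotangent law)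
  obtain ⟨𝔣', h𝔣'v, h𝔣't⟩ := exists_coneFrame_of_columns L H dV t ht g hg (cmPlaceOver L v₀) pm pp hne hm hp
  obtain ⟨wf, hwmem, hwne, hH⟩ := hcov 𝔣'
  have hRU := (adelicGroupData (↥(maximalRealSubfield L)) L (IsCMField.complexConj L) 2 H).isUnitary_rightRegular μA
  obtain ⟨hρ, μW, hfinW, hinvW, fW, Ψ₀, hθ, hθmem, hθne⟩ := hmeets
  haveI : IsFiniteMeasure μW := hfinW
  haveI : SMulInvariantMeasure ↥(UnitaryGroup.adelic (↥(maximalRealSubfield L)) L (IsCMField.complexConj L) 1 (JW (↥(maximalRealSubfield L)) L a'))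
      (↥(UnitaryGroup.adelic (↥(maximalRealSubfield L)) L (IsCMField.complexConj L) 1 (JW (↥(maximalRealSubfield L)) L a')) ⧸
        (UnitaryGroup.toAdelic (↥(maximalRealSubfield L)) L (IsCMField.complexConj L) 1 (JW (↥(maximalRealSubfield L)) L a')).range) μW := hinvW
  obtain ⟨φ, Φf, hφ⟩ := exists_tmul_inner_starProjection_toLp_lineThetaLift_ne_zero_of_mem L 2 H e₁ dV hdV hdV0 ιA hιA' μ' hμ' a' hρ μW fW P Ψ₀
    hθmem hθne hwmem hwne
  obtain ⟨Tθ, hTθ⟩ := exists_clm_comp_toLp_lineThetaLift_tmul L 2 H e₁ dV hdV hdV0 ιA hιA' μ' hμ' a' hρ μW fW μA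
    ((innerSL ℂ wf).comp P.space.toSubmodule.starProjection) Φf
  set eV := frameV L e₁ dV hdV hdV0 (lineW L (TW (↥(maximalRealSubfield L)) a')) (complexConj_lineW L (TW (↥(maximalRealSubfield L)) a'))
    (lineW_ne_zero L (TW (↥(maximalRealSubfield L)) a') (isUnit_det_TW (↥(maximalRealSubfield L)) a')) with heV
  obtain ⟨β, hβ⟩ : ∃ β : (Fin n' × {v : InfinitePlace (↥(maximalRealSubfield L)) // v.IsReal}) →₀ ℕ,
      ⟪wf, P.space.toSubmodule.starProjection (MemLp.toLp _ (memLp_toQuotFun_lineThetaLift L 2 H e₁ dV hdV hdV0 ιA hιA' μ' hμ' a' hρ μW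
          (piSchwartzBruhatEquiv (↥(maximalRealSubfield L)) (Fin n') (follandHermite eV β ⊗ₜ Φf)) fW μA 2))⟫_ℂ ≠ 0 := by
    by_contra hall
    push Not at hall
    have hT0 : Tθ.comp ((schwartzTransport eV).symm : _ ≃L[ℂ] _).toContinuousLinearMap = 0 :=
      clm_eq_of_eq_on_hermitePi fun β' => by
        show Tθ ((schwartzTransport eV).symm (hermitePi β')) = 0
        rw [hTθ]
        exact hall β'
    apply hφ
    have h1 : Tθ φ = 0 := by
      have := congrArg (fun S => S (schwartzTransport eV φ)) hT0
      simpa using this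
    rw [hTθ] at h1
    exact h1
  have hτ : (toHeckeCharacter L μ').HasUnitaryArchType hμ'.infinityType 0 :=
    (hasUnitaryArchType_toHeckeCharacter_iff L μ' _).2 hμ'.hasInfinityType_infinityType
  have hodd : ∀ w, Odd (hμ'.infinityType w) := hμ'.odd_infinityType
  have hchar : ∀ s : Fin 2 → ℂ, (∀ p, star (s p) * s p = 1) →
      ∏ p : Fin 2, s p ^ (if 0 < signVec (cmPlaceOver L) (cmGramEntry L e₁ dV hdV (lineW L (TW (↥(maximalRealSubfield L)) a'))
          (complexConj_lineW L (TW (↥(maximalRealSubfield L)) a'))) (imagUnit L) v₀ (e₁ (p, 0))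
        then (hμ'.infinityType (cmPlaceOver L v₀).1 + 1) / 2 + β (e₁ (p, 0), v₀)
        else (hμ'.infinityType (cmPlaceOver L v₀).1 + 1) / 2 - 1 - β (e₁ (p, 0), v₀)) = s pp * (s pm)⁻¹ := by
    intro s hs
    have hs0 : ∀ p, s p ≠ 0 := fun p h0 => by have := hs p; rw [h0, mul_zero] at this; exact zero_ne_one this
    obtain ⟨u, γ, hu, hγ, hcol⟩ := exists_archLocal_torus L 2 H dV t ht g hg ιA hιA (cmPlaceOver L v₀) s hs
    have hγv : ((γ : GL (Fin 2) ℂ) : Matrix (Fin 2) (Fin 2) ℂ) *ᵥ 𝔣'.v₀ = s pm • 𝔣'.v₀ := by rw [h𝔣'v]; exact hcol pm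
    have hγt : ((γ : GL (Fin 2) ℂ) : Matrix (Fin 2) (Fin 2) ℂ) *ᵥ 𝔣'.t₀ = s pp • 𝔣'.t₀ := by rw [h𝔣't]; exact hcol pp
    have hHγ := hH γ (s pm) (s pp) (hs0 pm) hγv hγt
    have hT := rightRegular_toLp_lineThetaLift_follandHermite_of_eq_adelicSingle L 2 H e₁ dV hdV hdV0 ιA hιA' μ' hμ' a' hρ μW fW μA v₀ hτ hodd
      s hs u hu _ hγ β Φf
    have key := hRU.inner_map_map (UnitaryGroup.adelicSingle (↥(maximalRealSubfield L)) L (IsCMField.complexConj L) 2 H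
      (IsCMField.complexConj_ne_one L) (UnitaryGroup.complexConj_smul_infinitePlace L) (cmPlaceOver L v₀) γ) wf
      (P.space.toSubmodule.starProjection (MemLp.toLp _ (memLp_toQuotFun_lineThetaLift L 2 H e₁ dV hdV hdV0 ιA hιA' μ' hμ' a' hρ μW
        (piSchwartzBruhatEquiv (↥(maximalRealSubfield L)) (Fin n') (follandHermite eV β ⊗ₜ Φf)) fW μA 2)))
    rw [hHγ, ← DiscreteAutomorphicRep.starProjection_rightRegular, hT, map_smul, inner_smul_left, inner_smul_right, ← mul_assoc] at key
    have h1 := (mul_eq_right₀ hβ).1 key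
    have h2 : (starRingEnd ℂ) (s pp * (s pm)⁻¹) * (s pp * (s pm)⁻¹) = 1 := by
      rw [map_mul, map_inv₀, ← Complex.star_def]
      calc star (s pp) * (star (s pm))⁻¹ * (s pp * (s pm)⁻¹) = (star (s pp) * s pp) * (star (s pm) * s pm)⁻¹ := by rw [mul_inv]; ring
        _ = 1 := by rw [hs pp, hs pm, inv_one, mul_one]
    have hne0 : (starRingEnd ℂ) (s pp * (s pm)⁻¹) ≠ 0 :=
      (map_ne_zero _).2 (mul_ne_zero (hs0 pp) (inv_ne_zero (hs0 pm)))
    exact mul_left_cancel₀ hne0 (h1.trans h2.symm)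
  have hvec := BallModel.eq_of_forall_prod_zpow_eq
    (fun p : Fin 2 => if 0 < signVec (cmPlaceOver L) (cmGramEntry L e₁ dV hdV (lineW L (TW (↥(maximalRealSubfield L)) a'))
          (complexConj_lineW L (TW (↥(maximalRealSubfield L)) a'))) (imagUnit L) v₀ (e₁ (p, 0))
        then (hμ'.infinityType (cmPlaceOver L v₀).1 + 1) / 2 + β (e₁ (p, 0), v₀)
        else (hμ'.infinityType (cmPlaceOver L v₀).1 + 1) / 2 - 1 - β (e₁ (p, 0), v₀))
    (fun p => if p = pp then 1 else if p = pm then -1 else 0) fun s hs => by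
      rw [hchar s hs, prod_zpow_two_indices s hne, zpow_one, _root_.zpow_neg, zpow_one]
  have hnp := congrFun hvec pp
  have hnm := congrFun hvec pm
  rw [if_pos rfl] at hnp
  rw [if_neg hne.symm, if_pos rfl] at hnm
  have hsign : ∀ p : Fin 2, signVec (cmPlaceOver L) (cmGramEntry L e₁ dV hdV (lineW L (TW (↥(maximalRealSubfield L)) a'))
      (complexConj_lineW L (TW (↥(maximalRealSubfield L)) a'))) (imagUnit L) v₀ (e₁ (p, 0)) =
      d p * (embedding_of_isReal v₀.2 (a' : ↥(maximalRealSubfield L)) / deltaIm (cmPlaceOver L) (imagUnit L) v₀) := fun p => by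
    rw [signVec_cmGramEntry_eq, Equiv.symm_apply_apply, mul_div_assoc]
    rfl
  have hδ0 : deltaIm (cmPlaceOver L) (imagUnit L) v₀ ≠ 0 :=
    deltaIm_ne_zero (IsCMField.complexConj_ne_one L) (cmPlaceOver_smul L) (complexConj_imagUnit L) (imagUnit_ne_zero L) v₀
  have hκ : embedding_of_isReal v₀.2 (a' : ↥(maximalRealSubfield L)) / deltaIm (cmPlaceOver L) (imagUnit L) v₀ ≠ 0 :=
    div_ne_zero ((map_ne_zero _).2 (Units.ne_zero a')) hδ0
  rw [hsign] at hnp hnm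
  have key := integer_equations₂ (c := (hμ'.infinityType (cmPlaceOver L v₀).1 + 1) / 2) hκ hpR hmR hnp hnm
  -- read-out: `(σ t).re = Re((σ t)⁻¹) · |σ t|²` and `Im σ(a′(2δ_L)⁻¹) = −ρ(a′)/(2δ)`
  have hN : 0 < Complex.normSq ((cmPlaceOver L v₀).1.embedding t) := Complex.normSq_pos.2 hσt0
  have hτre : ((cmPlaceOver L v₀).1.embedding t).re = τi * Complex.normSq ((cmPlaceOver L v₀).1.embedding t) := by
    rw [hτi, Complex.inv_re, div_mul_cancel₀ _ hN.ne']
  rw [hτre, im_embedding_cmPlaceOver_mul_inv_two_imagUnit L v₀ (a' : ↥(maximalRealSubfield L))]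
  have hkt := mul_pos key hN
  have h4 : τi * Complex.normSq ((cmPlaceOver L v₀).1.embedding t) *
      (-embedding_of_isReal v₀.2 (a' : ↥(maximalRealSubfield L)) / (2 * deltaIm (cmPlaceOver L) (imagUnit L) v₀)) =
      -(embedding_of_isReal v₀.2 (a' : ↥(maximalRealSubfield L)) / deltaIm (cmPlaceOver L) (imagUnit L) v₀ * τi *
        Complex.normSq ((cmPlaceOver L v₀).1.embedding t)) / 2 := by
    field_simp
  rw [h4]
  linarith

/-! ## §3 The relative corollary over organ (L)'s prefix: two meeting `P`, `P′` with torus-covariant vectors -/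

set_option maxHeartbeats 1600000 in
/-- **[Liu2021, Lem. D.2 (3)], RELATIVE FORM AT THE PLACE OF `ι`, FROM TORUS-COVARIANT VECTORS** (★ `im_mul_im_pos_of_meets_of_hol₂'` with the two
hol₂ binders replaced by `hcov`, `hcov′`).  For the letter's field ∕ frame ∕ signature ∕ definiteness ∕ degree data, a cone frame `𝔣` of `H` at
`cmPlace L ι` (witness that `Re((e♮ t)⁻¹) ≠ 0`), the pinned transport `ιA`, and discrete `P`, `P′` of `U(H)`: if `P` meets the theta lift from `⟨a′⟩` and `P′`
the one from `⟨a″⟩` at the conjugate-symplectic `λ` along `ιA`, and each contains, for every cone frame `𝔣′` at `cmPlace L ι`, a non-zero vector on which the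
torus of `𝔣′` acts by the cotangent character, then `0 < Im e♮(a′·(2·imagUnit L)⁻¹) · Im e♮(a″·(2·imagUnit L)⁻¹)`, `e♮ = (cmPlace L ι).1.embedding` (§2 twice;
in ROAD O `P = Q̄(a′,ξ)`, `P′ = Q̄(a″,ξ″)`, both `≃ᵤ` the hol₂ `P₀`, the vectors transported from `P₀`'s, §1).
[cite: Liu2021, App. D Lem. D.2 (3) (p. 127 L40 – p. 128 L2); proof of Prop. D.4 (1) (p. 131 L27–34); proof of Cor. B.6 (3) (p. 99 L41–46)] [cite: KonnoKonno2007, Thm. 5.4] -/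
theorem im_mul_im_pos_of_meets_of_torusCovariant (L : Type) [Field L] [NumberField L] [IsCMField L] (ι : L →+* ℂ) (H : Matrix (Fin 2) (Fin 2) L)
    (dV : Fin 2 → L) (hdV : ∀ i, IsCMField.complexConj L (dV i) = dV i) (hdV0 : ∀ i, dV i ≠ 0)
    (t : L) (ht : t ≠ 0) (g : GL (Fin 2) L)
    (hg : formCongr ((IsCMField.complexConj L : L ≃ₐ[↥(maximalRealSubfield L)] L) : L →+* L) g (t • H) = Matrix.diagonal dV)
    (hT : ∃ T : GL (Fin 2) ℂ, formCongr (starRingEnd ℂ) T ((Matrix.diagonal dV).map ι) = Matrix.diagonal ![(1 : ℂ), -1])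
    (hpos : ∀ τ' : L →+* ℂ, InfinitePlace.mk τ' ≠ InfinitePlace.mk ι → ((Matrix.diagonal dV).map τ').PosDef)
    (h4 : 4 ≤ Module.finrank ℚ L)
    (𝔣 : ConeFrame L H (cmPlace L ι))
    {μ : Measure (adelicGroupData (↥(maximalRealSubfield L)) L (IsCMField.complexConj L) 2 H).automorphicQuotient}
    [(adelicGroupData (↥(maximalRealSubfield L)) L (IsCMField.complexConj L) 2 H).IsAutomorphicMeasure μ]
    {n' : ℕ} (e₁ : Fin 2 × Fin 1 ≃ Fin n')
    (ιA : (adelicGroupData (↥(maximalRealSubfield L)) L (IsCMField.complexConj L) 2 H).Adelic →*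
      ↥(UnitaryGroup.adelic (↥(maximalRealSubfield L)) L (IsCMField.complexConj L) 2 (Matrix.diagonal dV)))
    (hιA : ∀ k, ((ιA k : ↥(UnitaryGroup.adelic (↥(maximalRealSubfield L)) L (IsCMField.complexConj L) 2 (Matrix.diagonal dV))) :
          GL (Fin 2) (AdeleRing (𝓞 L) L)) =
        (toAdeleGL L g)⁻¹ * adelicVal (↥(maximalRealSubfield L)) L (IsCMField.complexConj L) 2 H k * toAdeleGL L g)
    [CompactSpace (↥(UnitaryGroup.adelic (↥(maximalRealSubfield L)) L (IsCMField.complexConj L) 2 (Matrix.diagonal dV)) ⧸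
        (UnitaryGroup.toAdelic (↥(maximalRealSubfield L)) L (IsCMField.complexConj L) 2 (Matrix.diagonal dV)).range)]
    (P P' : DiscreteAutomorphicRep (adelicGroupData (↥(maximalRealSubfield L)) L (IsCMField.complexConj L) 2 H) μ)
    (lam : Literature.NumberTheory.Automorphic.IdeleClassGroup L →ₜ* Circle) (hlam : IsConjugateSymplectic L lam)
    (a' a'' : (↥(maximalRealSubfield L))ˣ)
    (hmeets : MeetsThetaLiftFromLine L 2 H e₁ dV hdV hdV0 P lam hlam a' ιA) (hmeets' : MeetsThetaLiftFromLine L 2 H e₁ dV hdV hdV0 P' lam hlam a'' ιA)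
    (hcov : ∀ 𝔣' : ConeFrame L H (cmPlace L ι), ∃ w ∈ P.space.toSubmodule, w ≠ 0 ∧
      ∀ (γ : archLocal L 2 H (cmPlace L ι)) (q a : ℂ), q ≠ 0 →
        ((γ : GL (Fin 2) ℂ) : Matrix (Fin 2) (Fin 2) ℂ) *ᵥ 𝔣'.v₀ = q • 𝔣'.v₀ →
        ((γ : GL (Fin 2) ℂ) : Matrix (Fin 2) (Fin 2) ℂ) *ᵥ 𝔣'.t₀ = a • 𝔣'.t₀ →
          (adelicGroupData (↥(maximalRealSubfield L)) L (IsCMField.complexConj L) 2 H).rightRegular μ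
              (UnitaryGroup.adelicSingle (↥(maximalRealSubfield L)) L (IsCMField.complexConj L) 2 H (IsCMField.complexConj_ne_one L)
                (UnitaryGroup.complexConj_smul_infinitePlace L) (cmPlace L ι) γ) w = (a * q⁻¹) • w)
    (hcov' : ∀ 𝔣' : ConeFrame L H (cmPlace L ι), ∃ w ∈ P'.space.toSubmodule, w ≠ 0 ∧
      ∀ (γ : archLocal L 2 H (cmPlace L ι)) (q a : ℂ), q ≠ 0 →
        ((γ : GL (Fin 2) ℂ) : Matrix (Fin 2) (Fin 2) ℂ) *ᵥ 𝔣'.v₀ = q • 𝔣'.v₀ →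
        ((γ : GL (Fin 2) ℂ) : Matrix (Fin 2) (Fin 2) ℂ) *ᵥ 𝔣'.t₀ = a • 𝔣'.t₀ →
          (adelicGroupData (↥(maximalRealSubfield L)) L (IsCMField.complexConj L) 2 H).rightRegular μ
              (UnitaryGroup.adelicSingle (↥(maximalRealSubfield L)) L (IsCMField.complexConj L) 2 H (IsCMField.complexConj_ne_one L)
                (UnitaryGroup.complexConj_smul_infinitePlace L) (cmPlace L ι) γ) w = (a * q⁻¹) • w) :
    0 < ((cmPlace L ι).1.embedding (algebraMap (↥(maximalRealSubfield L)) L a' * (2 * imagUnit L)⁻¹)).im *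
      ((cmPlace L ι).1.embedding (algebraMap (↥(maximalRealSubfield L)) L a'' * (2 * imagUnit L)⁻¹)).im := by
  haveI : CompactSpace (adelicGroupData (↥(maximalRealSubfield L)) L (IsCMField.complexConj L) 2 H).automorphicQuotient := by
    obtain ⟨τ, hτ⟩ := UnitaryGroup.exists_infinitePlace_ne L h4 ι
    exact UnitaryGroup.compactSpace_adelicGroupData_automorphicQuotient L 2 H
      (UnitaryGroup.anisotropic_of_formCongr_smul_eq_of_posDef L 2 H dV t ht g hg τ (hpos τ hτ))
  let v₀ : {v : InfinitePlace (↥(maximalRealSubfield L)) // v.IsReal} :=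
    ⟨(InfinitePlace.mk ι).comap (algebraMap (↥(maximalRealSubfield L)) L),
      Literature.NumberTheory.GelbartRogawski1991.UnitaryDualPair.ArchSplitting.QuadExt.isReal_comap_of_smul_eq (F := ↥(maximalRealSubfield L))
        (E := L) (c := IsCMField.complexConj L) (w := ⟨InfinitePlace.mk ι, IsTotallyComplex.isComplex _⟩) (UnitaryGroup.complexConj_smul_infinitePlace L _)
        (IsCMField.complexConj_ne_one L)⟩
  have hw₀ : (cmPlaceOver L v₀).1 = InfinitePlace.mk ι := comap_injective_of_isCMField (L := L) (cmPlaceOver_comap L v₀)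
  have hv₀ : cmPlace L ι = cmPlaceOver L v₀ := (Subtype.ext hw₀).symm
  -- `e♮(dV p) = ι(dV p)` is real; the phase-robust sign `τi = Re((e♮ t)⁻¹) ≠ 0` (from the cone frame)
  have hdVim : ∀ p, (ι (dV p)).im = 0 := fun p => by
    have h1 : ι (cmConjRingHom L (dV p)) = starRingEnd ℂ (ι (dV p)) := embedding_cmConjRingHom L ι (dV p)
    have h2 : cmConjRingHom L (dV p) = dV p := hdV p
    rw [h2] at h1
    exact Complex.conj_eq_iff_im.1 h1.symm
  have hedV : ∀ p, (cmPlace L ι).1.embedding (dV p) = (((ι (dV p)).re : ℝ) : ℂ) := fun p => by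
    rw [embedding_cmPlace_apply_of_im_eq_zero L ι (dV p) (hdVim p)]
    exact Complex.ext (by simp) (by simp [hdVim p])
  set τi : ℝ := (((cmPlace L ι).1.embedding t)⁻¹).re with hτi
  have hτi0 : τi ≠ 0 := re_inv_embedding_ne_zero_of_coneFrame L H dV hdV t ht g hg (cmPlace L ι) 𝔣
  have hre : ∀ p, ((cmPlace L ι).1.embedding (dV p) * ((cmPlace L ι).1.embedding t)⁻¹).re = (ι (dV p)).re * τi := fun p => by
    rw [hedV, Complex.re_ofReal_mul]
  -- the signature gives a negative and a positive `ι(dV p)`; the frame signs for EITHER sign of `τi`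
  obtain ⟨T, hT'⟩ := hT
  rw [Matrix.diagonal_map (map_zero ι)] at hT'
  obtain ⟨qm, qp, hne, hqm, hqp⟩ := exists_neg_pos_of_sig₂ (fun p => ι (dV p)) T hT'
  obtain ⟨pm, pp, hne', hm, hp⟩ : ∃ pm pp : Fin 2, pp ≠ pm ∧
      ((cmPlace L ι).1.embedding (dV pm) * ((cmPlace L ι).1.embedding t)⁻¹).re < 0 ∧
      0 < ((cmPlace L ι).1.embedding (dV pp) * ((cmPlace L ι).1.embedding t)⁻¹).re := by
    rcases lt_or_gt_of_ne hτi0 with hτ_neg | hτ_pos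
    · refine ⟨qp, qm, hne.symm, ?_, ?_⟩
      · rw [hre]; exact mul_neg_of_pos_of_neg hqp hτ_neg
      · rw [hre]; exact mul_pos_of_neg_of_neg hqm hτ_neg
    · refine ⟨qm, qp, hne, ?_, ?_⟩
      · rw [hre]; exact mul_neg_of_neg_of_pos hqm hτ_pos
      · rw [hre]; exact mul_pos hqp hτ_pos
  have k1 := re_mul_im_lt_zero_of_meets_of_torusCovariant L H dV hdV hdV0 t ht g hg v₀ (cmPlace L ι) hv₀ pm pp hne' hm hp e₁ ιA hιA P lam hlam a'
    hmeets hcov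
  have k2 := re_mul_im_lt_zero_of_meets_of_torusCovariant L H dV hdV hdV0 t ht g hg v₀ (cmPlace L ι) hv₀ pm pp hne' hm hp e₁ ιA hιA P' lam hlam a''
    hmeets' hcov'
  have k3 := mul_pos_of_neg_of_neg k1 k2
  have hr2 : 0 < ((cmPlace L ι).1.embedding t).re * ((cmPlace L ι).1.embedding t).re := by
    have hr0 : ((cmPlace L ι).1.embedding t).re ≠ 0 := fun h0 => hτi0 (by rw [hτi, Complex.inv_re, h0, zero_div])
    exact mul_self_pos.2 hr0
  nlinarith [k3, hr2]

/-- **MIXED FORM**: `P` holomorphic-cotangent at `cmPlace L ι` for `𝔣` (★ binder) and `P′` with torus-covariant vectors (ROAD O binder), meeting the theta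
lifts from `⟨a′⟩`, `⟨a″⟩` — same conclusion (§3 with `hcov := ` §1 on `P`; with §1 on both sides it is ★ `im_mul_im_pos_of_meets_of_hol₂'` verbatim).
[cite: Liu2021, App. D Lem. D.2 (3) (p. 127 L40 – p. 128 L2); proof of Prop. D.4 (1) (p. 131 L27–34)] [cite: KonnoKonno2007, Thm. 5.4] -/
theorem im_mul_im_pos_of_meets_of_hol₂_of_torusCovariant (L : Type) [Field L] [NumberField L] [IsCMField L] (ι : L →+* ℂ) (H : Matrix (Fin 2) (Fin 2) L)
    (dV : Fin 2 → L) (hdV : ∀ i, IsCMField.complexConj L (dV i) = dV i) (hdV0 : ∀ i, dV i ≠ 0)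
    (t : L) (ht : t ≠ 0) (g : GL (Fin 2) L)
    (hg : formCongr ((IsCMField.complexConj L : L ≃ₐ[↥(maximalRealSubfield L)] L) : L →+* L) g (t • H) = Matrix.diagonal dV)
    (hT : ∃ T : GL (Fin 2) ℂ, formCongr (starRingEnd ℂ) T ((Matrix.diagonal dV).map ι) = Matrix.diagonal ![(1 : ℂ), -1])
    (hpos : ∀ τ' : L →+* ℂ, InfinitePlace.mk τ' ≠ InfinitePlace.mk ι → ((Matrix.diagonal dV).map τ').PosDef)
    (h4 : 4 ≤ Module.finrank ℚ L)
    (𝔣 : ConeFrame L H (cmPlace L ι))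
    {μ : Measure (adelicGroupData (↥(maximalRealSubfield L)) L (IsCMField.complexConj L) 2 H).automorphicQuotient}
    [(adelicGroupData (↥(maximalRealSubfield L)) L (IsCMField.complexConj L) 2 H).IsAutomorphicMeasure μ]
    {n' : ℕ} (e₁ : Fin 2 × Fin 1 ≃ Fin n')
    (ιA : (adelicGroupData (↥(maximalRealSubfield L)) L (IsCMField.complexConj L) 2 H).Adelic →*
      ↥(UnitaryGroup.adelic (↥(maximalRealSubfield L)) L (IsCMField.complexConj L) 2 (Matrix.diagonal dV)))
    (hιA : ∀ k, ((ιA k : ↥(UnitaryGroup.adelic (↥(maximalRealSubfield L)) L (IsCMField.complexConj L) 2 (Matrix.diagonal dV))) :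
          GL (Fin 2) (AdeleRing (𝓞 L) L)) =
        (toAdeleGL L g)⁻¹ * adelicVal (↥(maximalRealSubfield L)) L (IsCMField.complexConj L) 2 H k * toAdeleGL L g)
    [CompactSpace (↥(UnitaryGroup.adelic (↥(maximalRealSubfield L)) L (IsCMField.complexConj L) 2 (Matrix.diagonal dV)) ⧸
        (UnitaryGroup.toAdelic (↥(maximalRealSubfield L)) L (IsCMField.complexConj L) 2 (Matrix.diagonal dV)).range)]
    (P P' : DiscreteAutomorphicRep (adelicGroupData (↥(maximalRealSubfield L)) L (IsCMField.complexConj L) 2 H) μ)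
    (lam : Literature.NumberTheory.Automorphic.IdeleClassGroup L →ₜ* Circle) (hlam : IsConjugateSymplectic L lam)
    (a' a'' : (↥(maximalRealSubfield L))ˣ)
    (hmeets : MeetsThetaLiftFromLine L 2 H e₁ dV hdV hdV0 P lam hlam a' ιA) (hmeets' : MeetsThetaLiftFromLine L 2 H e₁ dV hdV hdV0 P' lam hlam a'' ιA)
    (hhol : P.IsHolCotangentAt₂ (IsCMField.complexConj_ne_one L) (UnitaryGroup.complexConj_smul_infinitePlace L) (cmPlace L ι) 𝔣)
    (hcov' : ∀ 𝔣' : ConeFrame L H (cmPlace L ι), ∃ w ∈ P'.space.toSubmodule, w ≠ 0 ∧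
      ∀ (γ : archLocal L 2 H (cmPlace L ι)) (q a : ℂ), q ≠ 0 →
        ((γ : GL (Fin 2) ℂ) : Matrix (Fin 2) (Fin 2) ℂ) *ᵥ 𝔣'.v₀ = q • 𝔣'.v₀ →
        ((γ : GL (Fin 2) ℂ) : Matrix (Fin 2) (Fin 2) ℂ) *ᵥ 𝔣'.t₀ = a • 𝔣'.t₀ →
          (adelicGroupData (↥(maximalRealSubfield L)) L (IsCMField.complexConj L) 2 H).rightRegular μ
              (UnitaryGroup.adelicSingle (↥(maximalRealSubfield L)) L (IsCMField.complexConj L) 2 H (IsCMField.complexConj_ne_one L)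
                (UnitaryGroup.complexConj_smul_infinitePlace L) (cmPlace L ι) γ) w = (a * q⁻¹) • w) :
    0 < ((cmPlace L ι).1.embedding (algebraMap (↥(maximalRealSubfield L)) L a' * (2 * imagUnit L)⁻¹)).im *
      ((cmPlace L ι).1.embedding (algebraMap (↥(maximalRealSubfield L)) L a'' * (2 * imagUnit L)⁻¹)).im :=
  haveI : CompactSpace (adelicGroupData (↥(maximalRealSubfield L)) L (IsCMField.complexConj L) 2 H).automorphicQuotient := by
    obtain ⟨τ, hτ⟩ := UnitaryGroup.exists_infinitePlace_ne L h4 ι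
    exact UnitaryGroup.compactSpace_adelicGroupData_automorphicQuotient L 2 H
      (UnitaryGroup.anisotropic_of_formCongr_smul_eq_of_posDef L 2 H dV t ht g hg τ (hpos τ hτ))
  im_mul_im_pos_of_meets_of_torusCovariant L ι H dV hdV hdV0 t ht g hg hT hpos h4 𝔣 e₁ ιA hιA P P' lam hlam a' a'' hmeets hmeets'
    (torusCovariant_of_isHolCotangentAt₂ L H dV hdV t ht g hg (cmPlace L ι) 𝔣 P hhol) hcov'

end Summit.HodgeConjecture.HodgeConjecture.Cruxes.HLiu418.F0LD2ArchSignOfTorusCovariant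
end
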